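import Literature.AlgebraicGeometry.Resolution.ArithmeticalThreefoldsLocalDescentInertiaHensel
import Literature.AlgebraicGeometry.Resolution.LocalBlowup
import Mathlib.LinearAlgebra.Matrix.Determinant.Basic
import HarnessLib

/-!
# hand-1 g11 — the GEOMETRIC HEAD of `hDec` ([CoP1] Prop. 9.3, decomposition layer): Prop. 8.1 + (47)-robust, as ONE Lean hypothesis

Crux workfile (not a Theorems file). `HDecHead` packages, in the frame of
`cossartPiltant2019ReductionP_of_cjs_of_stableInertiaHensel` (hypothesis `hDec`), the output of
[CoP1] Prop. 8.1 applied to the normal local model `R₁′ := (S[t₁ ∪ t₁′])_𝔪` of `K′` above a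
normal model `R₁ := (S[t₁])_𝔪` of `M`, together with the ROBUST form of (47): the non-exceptional
regular parameters of the local uniformization `S′` are units times strict transforms of
elements of `R₁′`. Everything AFTER the head is kernel algebra landed in g11
(`SplittingRingUnramified`, `GaloisApproximationSplitting`, `MonomialAdjugate`,
`StrictTransformApproximation`, `NormalModels`, `DenseRegularDescent`, and the tree's
`ArithmeticalThreefoldsDescentTail.isRegularLocalRing_of_descent_core`). The intended theorem is
`hDec_of_head : HDecHead → hDec-shape` (statement below, proof = g12's task).
-/

noncomputable section

open IsLocalRing Polynomial IntermediateField

namespace Literature.AlgebraicGeometry.Resolution.HDecHeadSketch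

universe u

/-- **The head of `hDec`** ([CoP1] Prop. 8.1 for the normal local model `R₁′` of `K′ ⊆ Kˢ`
above a normal model `R₁` of `M`, plus (47) in robust form). Binders: the frame of `hDec`; a
normal model `S[t₁] ⊆ O ∩ M` of `M` (integrally closed in `M`); its integral closure
`S[t₁ ∪ t₁′]` in `K′`; a local uniformization of `K′` exists. Output: a local uniformization
`S′ = (S[t′])_𝔪` of `K′` containing `S[t₁ ∪ t₁′]`, a regular system of parameters
`x₀, x₁, x₂` of `S′` and `r ≤ 3` such that (a) `𝔪_{R₁′} S′ ⊆ (x₀⋯x_{r-1}) S′`; (b) elements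
`f_i ∈ M` (`i < r`) which in `S′` are units times monomials `∏_{j<r} x_j^{a_ij}` with
`det (a_ij) ≠ 0` ("`W x₁, …, W x_r` linearly independent", `f_i ∈ R₁` with independent values);
(c) for `r ≤ j < 3`, an element `g_j ∈ R₁′` with `g_j = u_j · x_j · ∏_{i<r} x_i^{c_ij}` in `S′`,
`u_j` a unit (the strict transform of `g_j` is `x_j` up to a unit).
[cite: CossartPiltant2008, Prop. 8.1 and proof of Prop. 9.3 (46)–(47) (HAL pp. 22, 27–28)] -/
def HDecHead : Prop :=
  ∀ (p : ℕ), p.Prime →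
  ∀ (S : Type u) [CommRing S] [IsDomain S] [IsRegularLocalRing S],
    IsExcellentRing S → ringKrullDim S = 3 → CharP (ResidueField S) p →
    IsAdicComplete (maximalIdeal S) S →
  ∀ (E : Type u) [Field E] [Algebra S E], Function.Injective (algebraMap S E) →
    IsAlgClosed E → Algebra.IsAlgebraic S E →
  ∀ (OE : ValuationSubring E), (∀ s : S, algebraMap S E s ∈ OE) →
    (∀ s ∈ maximalIdeal S, OE.valuation (algebraMap S E s) < 1) →
    (∀ y : OE, ∃ q : S[X], (∃ i, q.coeff i ∉ maximalIdeal S) ∧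
      OE.valuation (q.eval₂ (algebraMap S E) y) < 1) →
  Nonempty OE.valuation.RankOne →
  ∀ (M : Subfield E), (∀ s : S, algebraMap S E s ∈ M) →
  ∀ (N : IntermediateField M E) [FiniteDimensional M N] [IsGalois M N] (K' : Subfield E),
    M ≤ K' → K' ≤ (lift (fixedField (decompositionGroupIn OE N))).toSubfield →
  -- a local uniformization of `K′` exists
  (∃ t : Finset E, (t : Set E) ⊆ K' ∧
    K' ≤ Subfield.closure (Set.range (algebraMap S E) ∪ (t : Set E)) ∧
    ∃ hTO : (Algebra.adjoin S (t : Set E)).toSubring ≤ OE.toSubring,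
      IsRegularLocalRing (Localization.AtPrime
        (Ideal.comap (Subring.inclusion hTO) (maximalIdeal OE)))) →
  -- a normal model `S[t₁]` of `M` inside `O` and its integral closure `S[t₁ ∪ t₁′]` in `K′`
  ∀ (t₁ : Finset E), (t₁ : Set E) ⊆ M →
    M ≤ Subfield.closure (Set.range (algebraMap S E) ∪ (t₁ : Set E)) →
    (Algebra.adjoin S (t₁ : Set E)).toSubring ≤ OE.toSubring →
    (∀ x : E, x ∈ M → IsIntegral (Algebra.adjoin S (t₁ : Set E)) x →
      x ∈ Algebra.adjoin S (t₁ : Set E)) →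
  ∀ (t₁' : Finset E), (t₁' : Set E) ⊆ K' →
    (∀ x : E, x ∈ K' → (IsIntegral (Algebra.adjoin S (t₁ : Set E)) x ↔
      x ∈ Algebra.adjoin S ((t₁ : Set E) ∪ (t₁' : Set E)))) →
  -- OUTPUT
  ∃ (t' : Finset E) (_ : (t' : Set E) ⊆ K')
    (_ : K' ≤ Subfield.closure (Set.range (algebraMap S E) ∪ (t' : Set E)))
    (hTO' : (Algebra.adjoin S (t' : Set E)).toSubring ≤ OE.toSubring)
    (_ : Algebra.adjoin S ((t₁ : Set E) ∪ (t₁' : Set E)) ≤ Algebra.adjoin S (t' : Set E))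
    (_ : IsRegularLocalRing (locAtCentre (Algebra.adjoin S (t' : Set E)).toSubring OE))
    (r : ℕ) (hr : r ≤ 3)
    (x : Fin 3 → locAtCentre (Algebra.adjoin S (t' : Set E)).toSubring OE),
    -- `(x₀, x₁, x₂)` is a regular system of parameters of `S′`
    (haveI := isLocalRing_locAtCentre hTO'
     Ideal.span (Set.range x) = maximalIdeal (locAtCentre (Algebra.adjoin S (t' : Set E)).toSubring OE)) ∧
    -- (a) `𝔪_{R₁′} S′ ⊆ (x₀ ⋯ x_{r-1}) S′`
    (∀ y : locAtCentre (Algebra.adjoin S (t' : Set E)).toSubring OE,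
      (y : E) ∈ locAtCentre (Algebra.adjoin S ((t₁ : Set E) ∪ (t₁' : Set E))).toSubring OE →
      OE.valuation (y : E) < 1 →
      y ∈ Ideal.span {∏ i : Fin r, x (Fin.castLE hr i)}) ∧
    -- (b) monomial elements of `M` with independent exponent vectors
    (∃ (f : Fin r → E) (γ : Fin r → (locAtCentre (Algebra.adjoin S (t' : Set E)).toSubring OE)ˣ)
      (a : Matrix (Fin r) (Fin r) ℕ),
      (∀ i, f i ∈ M) ∧
      (∀ i, f i = ((γ i : locAtCentre (Algebra.adjoin S (t' : Set E)).toSubring OE) : E) *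
        ∏ j : Fin r, ((x (Fin.castLE hr j) : E)) ^ a i j) ∧
      (a.map (Int.ofNat : ℕ → ℤ)).det ≠ 0) ∧
    -- (c) the non-exceptional parameters are units times strict transforms of elements of `R₁′`
    (∀ j : Fin 3, r ≤ (j : ℕ) →
      ∃ (g : E) (u : (locAtCentre (Algebra.adjoin S (t' : Set E)).toSubring OE)ˣ) (c : Fin r → ℕ),
        g ∈ locAtCentre (Algebra.adjoin S ((t₁ : Set E) ∪ (t₁' : Set E))).toSubring OE ∧
        g = ((u : locAtCentre (Algebra.adjoin S (t' : Set E)).toSubring OE) : E) * (x j : E) *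
          ∏ i : Fin r, ((x (Fin.castLE hr i) : E)) ^ c i)

end Literature.AlgebraicGeometry.Resolution.HDecHeadSketch

end
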